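import Mathlib

/-!
# Route ClusUniversalCertificate — the hypercube certificate inequality, I: polynomial tools and the rich-vs-heavy count

Helper file for `stmt-PneNP-19683` (`UniversalCertAll`, the universal block affine-slice certificate
R★★_b of route-PneNP-ClusUniversalCertificate, rung F-N1 of the PneNP frontier ladder, cell
pnp-ideate; NOT summit-closing, no bearing on `P ≠ NP` by itself). This file and its two sequels land
the cell's complete proof of the `m = 1` (hypercube) case (cell record
HOME/pnp-ideate-lit/UniversalCertificate.lean, literature seat, 2026-08-25; paper proof ROUND-5 §T),
namely `∀ Y ⊆ 𝔽₂ⁿ, Σ_{y∈Y} (n − codim_Y(y)) ≤ Σ_k 2·#{y ∈ Y : y_k = 0}`.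

Part I (this file): the 0/1 points and weights of the cube; **Lemma Z** (`lemmaZ`: a polynomial over
`𝔽₂` of total degree `≤ d` vanishing at all cube points of weight `≥ N − d` vanishes on the cube — a
parity count of coefficient upper-sums); **Lemma F** (`flatInd_lowDegree`: the indicator of a coset of
a `θ`-dimensional subspace is a polynomial function of degree `≤ N − θ`); **Theorem D**
(`card_rich_le_card_heavy`: if every point of `A` carries an upward `θ`-flat inside `Y` then
`|A| ≤ #{t ∈ Y : wt t ≥ θ}`). [folklore linear algebra over `𝔽₂`; cell record ROUND-5 §T]
-/

set_option linter.dupNamespace false -- `Summit.PneNP.PneNP.…`: summit = sub-problem name (D-0017 single-conjunct layout)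

namespace Summit.PneNP.PneNP.Theorems.ClusCube

open Classical Finset MvPolynomial

noncomputable section

/-- The hypercube as an `𝔽₂`-vector space. -/
abbrev V (N : ℕ) := Fin N → ZMod 2

variable {N : ℕ}

/-- support of a point -/
def supp (x : V N) : Finset (Fin N) := univ.filter fun i => x i ≠ 0

/-- Hamming weight -/
def wt (x : V N) : ℕ := (supp x).card

/-- the 0/1 point with prescribed support -/
def pt (S : Finset (Fin N)) : V N := fun i => if i ∈ S then 1 else 0

/-- Every element of `ZMod 2` is `0` or `1`. -/
private lemma zmod2_eq_zero_or_one (z : ZMod 2) : z = 0 ∨ z = 1 := by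
  fin_cases z
  · exact Or.inl rfl
  · exact Or.inr rfl

/-- Membership in the support. -/
@[simp] lemma mem_supp {x : V N} {i : Fin N} : i ∈ supp x ↔ x i ≠ 0 := by
  simp [supp]

/-- A point of the cube is the 0/1 point of its support. -/
lemma pt_supp (x : V N) : pt (supp x) = x := by
  funext i
  rcases zmod2_eq_zero_or_one (x i) with h | h <;> simp [pt, h]

/-- The support of the 0/1 point of `S` is `S`. -/
lemma supp_pt (S : Finset (Fin N)) : supp (pt S) = S := by
  ext i; simp [supp, pt]

/-- The Hamming weight is at most the dimension. -/
lemma wt_le (x : V N) : wt x ≤ N := by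
  unfold wt
  exact (card_le_univ _).trans (by simp)

/-- evaluation of a polynomial at the 0/1 point `pt S` -/
lemma eval_pt (S : Finset (Fin N)) (f : MvPolynomial (Fin N) (ZMod 2)) :
    eval (pt S) f = ∑ d ∈ f.support, (if d.support ⊆ S then f.coeff d else 0) := by
  rw [eval_eq]
  refine sum_congr rfl fun d _ => ?_
  have h1 : ∀ i ∈ d.support, (pt S) i ^ d i = (if i ∈ S then (1 : ZMod 2) else 0) := by
    intro i hi
    have hdi : d i ≠ 0 := Finsupp.mem_support_iff.mp hi
    by_cases h : i ∈ S
    · simp [pt, h]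
    · simp [pt, h, zero_pow hdi]
  rw [prod_congr rfl h1, prod_boole]
  by_cases h : d.support ⊆ S
  · have h' : ∀ i ∈ d.support, i ∈ S := fun i hi => h hi
    rw [if_pos h', if_pos h, mul_one]
  · have h' : ¬ ∀ i ∈ d.support, i ∈ S := fun hh => h (fun i hi => hh i hi)
    rw [if_neg h', if_neg h, mul_zero]

/-- in `ZMod 2`, a constant summed over a power set vanishes unless the set is empty -/
lemma sum_powerset_const (S : Finset (Fin N)) (c : ZMod 2) :
    (∑ _U ∈ S.powerset, c) = if S = ∅ then c else 0 := by
  rw [sum_const, card_powerset, nsmul_eq_mul, Nat.cast_pow]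
  have h2 : ((2 : ℕ) : ZMod 2) = 0 := by decide
  rw [h2]
  by_cases h : S = ∅
  · simp [h]
  · rw [if_neg h, zero_pow (by rwa [Ne, card_eq_zero]), zero_mul]

/-- Summing a constant over the subsets of `T ∪ D` containing `T` (for `D` disjoint from `T`). -/
lemma sum_powerset_disjoint (T D : Finset (Fin N)) (c : ZMod 2) :
    (∑ U ∈ T.powerset, if Disjoint D U then c else 0) = if T ⊆ D then c else 0 := by
  rw [← sum_filter]
  have : T.powerset.filter (fun U => Disjoint D U) = (T \ D).powerset := by
    ext U
    simp only [mem_filter, mem_powerset, subset_sdiff]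
    constructor
    · rintro ⟨h1, h2⟩; exact ⟨h1, h2.symm⟩
    · rintro ⟨h1, h2⟩; exact ⟨h1, h2.symm⟩
  rw [this, sum_powerset_const]
  simp [sdiff_eq_empty_iff_subset]

/-- Summing a constant over the subsets of `D` containing `C`. -/
lemma sum_powerset_subset (C D : Finset (Fin N)) (c : ZMod 2) :
    (∑ T ∈ C.powerset, if T ⊆ D then c else 0) = if C ∩ D = ∅ then c else 0 := by
  rw [← sum_filter]
  have : C.powerset.filter (fun T => T ⊆ D) = (C ∩ D).powerset := by
    ext T
    simp only [mem_filter, mem_powerset, subset_inter_iff]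
  rw [this, sum_powerset_const]

/-- the "upper sums" of the coefficients: `s_T = Σ_{d : supp d ⊇ T} coeff d` -/
def sT (f : MvPolynomial (Fin N) (ZMod 2)) (T : Finset (Fin N)) : ZMod 2 :=
  ∑ d ∈ f.support, if T ⊆ d.support then f.coeff d else 0

/-- The upper coefficient sum `s_T` as a sum of evaluations at the 0/1 points above `T`. -/
lemma sT_eq_sum_eval (f : MvPolynomial (Fin N) (ZMod 2)) (T : Finset (Fin N)) :
    sT f T = ∑ U ∈ T.powerset, eval (pt Uᶜ) f := by
  unfold sT
  simp_rw [eval_pt]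
  rw [sum_comm]
  refine sum_congr rfl fun d _ => ?_
  have hiff : ∀ U : Finset (Fin N), d.support ⊆ Uᶜ ↔ Disjoint d.support U := by
    intro U
    rw [Finset.disjoint_left]
    simp only [Finset.subset_iff, Finset.mem_compl]
  have hc : ∀ U ∈ T.powerset, (if d.support ⊆ Uᶜ then f.coeff d else 0)
      = (if Disjoint d.support U then f.coeff d else 0) := by
    intro U _
    by_cases h : Disjoint d.support U
    · rw [if_pos ((hiff U).mpr h), if_pos h]
    · rw [if_neg (mt (hiff U).mp h), if_neg h]
  rw [eq_comm, sum_congr rfl hc, sum_powerset_disjoint]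

/-- the number of variables occurring in an exponent vector is at most its degree -/
lemma card_support_le_degree (d : Fin N →₀ ℕ) : d.support.card ≤ d.sum fun _ e => e := by
  unfold Finsupp.sum
  rw [card_eq_sum_ones]
  exact sum_le_sum fun i hi => Nat.one_le_iff_ne_zero.mpr (Finsupp.mem_support_iff.mp hi)

/-- Upper coefficient sums of a polynomial of degree `≤ d` vanish when it vanishes at all points of weight `≥ N − d`. -/
lemma sT_eq_zero (f : MvPolynomial (Fin N) (ZMod 2)) (d : ℕ) (hdeg : f.totalDegree ≤ d)
    (hvan : ∀ x : V N, N ≤ wt x + d → eval x f = 0) (T : Finset (Fin N)) : sT f T = 0 := by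
  by_cases hT : T.card ≤ d
  · rw [sT_eq_sum_eval]
    refine sum_eq_zero fun U hU => hvan _ ?_
    have hUT : U.card ≤ T.card := card_le_card (mem_powerset.mp hU)
    have hwt : wt (pt Uᶜ : V N) = N - U.card := by
      rw [wt, supp_pt, card_compl, Fintype.card_fin]
    have hUN : U.card ≤ N := (card_le_univ U).trans (by simp)
    omega
  · unfold sT
    refine sum_eq_zero fun e he => ?_
    rw [if_neg]
    intro hsub
    have h1 : T.card ≤ e.support.card := card_le_card hsub
    have h2 : e.support.card ≤ e.sum (fun _ k => k) := card_support_le_degree e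
    have h3 : (e.sum fun _ k => k) ≤ f.totalDegree := le_totalDegree he
    omega

/-- `Sᶜ ∩ D = ∅ ↔ D ⊆ S`. -/
lemma compl_inter_eq_empty_iff (S D : Finset (Fin N)) : Sᶜ ∩ D = ∅ ↔ D ⊆ S := by
  constructor
  · intro h a ha
    by_contra hS
    have : a ∈ Sᶜ ∩ D := mem_inter.mpr ⟨mem_compl.mpr hS, ha⟩
    rw [h] at this
    exact absurd this (by simp)
  · intro h
    ext a
    simp only [mem_inter, mem_compl]
    constructor
    · rintro ⟨h1, h2⟩; exact absurd (h h2) h1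
    · intro ha; exact absurd ha (by simp)

/-- **Lemma Z.**  A polynomial over `𝔽₂` of total degree `≤ d` that vanishes at every point of
the cube of Hamming weight `≥ N - d` vanishes at every point of the cube. -/
theorem lemmaZ (f : MvPolynomial (Fin N) (ZMod 2)) (d : ℕ) (hdeg : f.totalDegree ≤ d)
    (hvan : ∀ x : V N, N ≤ wt x + d → eval x f = 0) (x : V N) : eval x f = 0 := by
  have key : eval x f = ∑ T ∈ (supp x)ᶜ.powerset, sT f T := by
    conv_lhs => rw [← pt_supp x]
    rw [eval_pt]
    unfold sT
    rw [sum_comm]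
    refine sum_congr rfl fun e _ => ?_
    rw [sum_powerset_subset]
    by_cases h : e.support ⊆ supp x
    · rw [if_pos h, if_pos ((compl_inter_eq_empty_iff _ _).mpr h)]
    · rw [if_neg h, if_neg (mt (compl_inter_eq_empty_iff _ _).mp h)]
  rw [key]
  exact sum_eq_zero fun T _ => sT_eq_zero f d hdeg hvan T

/-! ## Lemma F: indicators of affine flats have low degree -/

/-- the indicator function of the coset `a + W` -/
def flatInd (a : V N) (W : Submodule (ZMod 2) (V N)) (x : V N) : ZMod 2 :=
  if x - a ∈ W then 1 else 0

/-- In `ZMod 2`, `1 + z` is the indicator of `z = 0`. -/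
lemma one_add_eq_ite (z : ZMod 2) : 1 + z = if z = 0 then 1 else 0 := by
  rcases zmod2_eq_zero_or_one z with h | h <;> subst h <;> decide

/-- **Lemma F.** The indicator of a coset of a subspace `W` is a polynomial function of total
degree at most `N - dim W`. -/
theorem flatInd_lowDegree (a : V N) (W : Submodule (ZMod 2) (V N)) :
    ∃ P : MvPolynomial (Fin N) (ZMod 2),
      P.totalDegree + Module.finrank (ZMod 2) W ≤ N ∧ ∀ x, eval x P = flatInd a W x := by
  let r := Module.finrank (ZMod 2) W.dualAnnihilator
  let b := Module.finBasis (ZMod 2) W.dualAnnihilator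
  have hrank : Module.finrank (ZMod 2) W + r = N := by
    have := Subspace.finrank_add_finrank_dualAnnihilator_eq W
    simpa using this
  -- membership criterion through the annihilator basis
  have hmem : ∀ v : V N, v ∈ W ↔ ∀ j, (b j : Module.Dual (ZMod 2) (V N)) v = 0 := by
    intro v
    constructor
    · intro hv j
      exact (Submodule.mem_dualAnnihilator _).mp (b j).2 v hv
    · intro hv
      rw [← Subspace.forall_mem_dualAnnihilator_apply_eq_zero_iff W v]
      intro φ hφ
      have hrepr := b.sum_repr ⟨φ, hφ⟩
      have hφ' : φ = ∑ j, b.repr ⟨φ, hφ⟩ j • (b j : Module.Dual (ZMod 2) (V N)) := by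
        have := congrArg Subtype.val hrepr
        rw [Submodule.coe_sum] at this
        simp only [Submodule.coe_smul] at this
        exact this.symm
      rw [hφ', LinearMap.sum_apply]
      refine sum_eq_zero fun j _ => ?_
      rw [LinearMap.smul_apply, hv j, smul_zero]
  -- the affine forms as degree-one polynomials
  let e : Fin N → V N := fun i k => if i = k then 1 else 0
  let Q : Fin r → MvPolynomial (Fin N) (ZMod 2) := fun j =>
    C (1 - (b j : Module.Dual (ZMod 2) (V N)) a) +
      ∑ i, C ((b j : Module.Dual (ZMod 2) (V N)) (e i)) * X i
  have hQeval : ∀ j x, eval x (Q j) = 1 + (b j : Module.Dual (ZMod 2) (V N)) (x - a) := by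
    intro j x
    simp only [Q, map_add, map_sum, map_mul, eval_C, eval_X, map_sub]
    rw [LinearMap.pi_apply_eq_sum_univ (b j : Module.Dual (ZMod 2) (V N)) x]
    have : ∑ i, (b j : Module.Dual (ZMod 2) (V N)) (e i) * x i
        = ∑ i, x i • (b j : Module.Dual (ZMod 2) (V N)) (e i) :=
      Finset.sum_congr rfl fun i _ => by rw [smul_eq_mul, mul_comm]
    rw [this]
    ring
  have hQdeg : ∀ j, (Q j).totalDegree ≤ 1 := by
    intro j
    refine (totalDegree_add _ _).trans (max_le ?_ ?_)
    · rw [totalDegree_C]; exact zero_le_one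
    · refine totalDegree_finsetSum_le fun i _ => ?_
      refine (totalDegree_mul _ _).trans ?_
      rw [totalDegree_C, zero_add]
      exact (totalDegree_X _).le
  refine ⟨∏ j, Q j, ?_, ?_⟩
  · have h1 : (∏ j, Q j).totalDegree ≤ r := by
      refine (totalDegree_finsetProd _ _).trans ?_
      calc ∑ j, (Q j).totalDegree ≤ ∑ _j : Fin r, 1 := sum_le_sum fun j _ => hQdeg j
        _ = r := by simp [r]
    omega
  · intro x
    rw [map_prod]
    simp_rw [hQeval, one_add_eq_ite]
    rw [Fintype.prod_boole]
    unfold flatInd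
    by_cases hx : x - a ∈ W
    · rw [if_pos hx, if_pos ((hmem _).mp hx)]
    · rw [if_neg hx, if_neg (mt (hmem _).mpr hx)]

/-! ## Lemma O / Theorem D: rich points are no more numerous than heavy points -/

/-- `U` is upward at `a`: the supports of its vectors avoid `supp a` -/
def Upward (a : V N) (U : Submodule (ZMod 2) (V N)) : Prop :=
  ∀ v ∈ U, ∀ i, a i ≠ 0 → v i = 0

/-- Weights add for points with disjoint supports. -/
lemma wt_add_of_upward {a v : V N} (h : ∀ i, a i ≠ 0 → v i = 0) :
    wt (a + v) = wt a + wt v := by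
  unfold wt
  have hdisj : Disjoint (supp a) (supp v) := by
    rw [Finset.disjoint_left]
    intro i hi
    rw [mem_supp] at hi
    rw [mem_supp, not_not]
    exact h i hi
  have hunion : supp (a + v) = supp a ∪ supp v := by
    ext i
    simp only [mem_supp, mem_union, Pi.add_apply]
    rcases zmod2_eq_zero_or_one (a i) with ha | ha
    · simp [ha]
    · have hv : v i = 0 := h i (by rw [ha]; exact one_ne_zero)
      rw [ha, hv]
      decide
  rw [hunion, card_union_of_disjoint hdisj]

/-- A point of weight `0` is `0`. -/
lemma eq_zero_of_wt_eq_zero {v : V N} (h : wt v = 0) : v = 0 := by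
  unfold wt at h
  rw [card_eq_zero] at h
  funext i
  by_contra hi
  have : i ∈ supp v := mem_supp.mpr hi
  rw [h] at this
  exact absurd this (by simp)

/-- **Theorem D (cardinality form).**  If every point of `A` carries an upward `θ`-dimensional
flat inside `Y`, then `|A|` is at most the number of points of `Y` of weight `≥ θ`. -/
theorem card_rich_le_card_heavy (Y A : Finset (V N)) (θ : ℕ)
    (Va : V N → Submodule (ZMod 2) (V N))
    (hup : ∀ a ∈ A, Upward a (Va a))
    (hdim : ∀ a ∈ A, Module.finrank (ZMod 2) (Va a) = θ)
    (hY : ∀ a ∈ A, ∀ v ∈ Va a, a + v ∈ Y) :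
    A.card ≤ (Y.filter fun t => θ ≤ wt t).card := by
  rcases A.eq_empty_or_nonempty with hA | ⟨a₁, ha₁⟩
  · simp [hA]
  have hθN : θ ≤ N := by
    rw [← hdim a₁ ha₁]
    exact (Submodule.finrank_le (Va a₁)).trans (by simp)
  set H := Y.filter fun t => θ ≤ wt t with hH
  let row : A → (H → ZMod 2) := fun a t => flatInd (a : V N) (Va a) t
  have hli : LinearIndependent (ZMod 2) row := by
    rw [linearIndependent_iff']
    intro s g hsum a ha
    by_contra hga
    let F : V N → ZMod 2 := fun x => ∑ a ∈ s, g a * flatInd (a : V N) (Va a) x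
    -- F vanishes on all heavy points
    have hF0 : ∀ x : V N, θ ≤ wt x → F x = 0 := by
      intro x hx
      by_cases hxY : x ∈ Y
      · have hxH : x ∈ H := by rw [hH]; exact mem_filter.mpr ⟨hxY, hx⟩
        have := congrFun hsum ⟨x, hxH⟩
        simpa [row, Finset.sum_apply, Pi.smul_apply, smul_eq_mul] using this
      · refine sum_eq_zero fun a _ => ?_
        have : flatInd (a : V N) (Va a) x = 0 := by
          unfold flatInd
          rw [if_neg]
          intro hmem
          have := hY a a.2 _ hmem
          rw [add_sub_cancel] at this
          exact hxY this
        rw [this, mul_zero]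
    -- F is a polynomial function of degree ≤ N - θ
    have hpoly : ∃ P : MvPolynomial (Fin N) (ZMod 2),
        P.totalDegree ≤ N - θ ∧ ∀ x, eval x P = F x := by
      choose P hP using fun a : A => flatInd_lowDegree (a : V N) (Va a)
      refine ⟨∑ a ∈ s, C (g a) * P a, ?_, ?_⟩
      · refine totalDegree_finsetSum_le fun a _ => ?_
        refine (totalDegree_mul _ _).trans ?_
        rw [totalDegree_C, zero_add]
        have h1 := (hP a).1
        have h2 := hdim a a.2
        omega
      · intro x
        simp only [map_sum, map_mul, eval_C, F]
        exact Finset.sum_congr rfl fun a _ => by rw [(hP a).2]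
    obtain ⟨P, hPdeg, hPev⟩ := hpoly
    have hFzero : ∀ x, F x = 0 := by
      intro x
      rw [← hPev]
      refine lemmaZ P (N - θ) hPdeg (fun x' hx' => ?_) x
      rw [hPev]
      exact hF0 x' (by omega)
    -- a base point of minimum weight among those with nonzero coefficient is covered once
    set S' := s.filter fun a => g a ≠ 0 with hS'
    have hne : S'.Nonempty := ⟨a, by rw [hS']; exact mem_filter.mpr ⟨ha, hga⟩⟩
    obtain ⟨a₀, ha₀, hmin⟩ := S'.exists_min_image (fun a => wt (a : V N)) hne
    have ha₀s : a₀ ∈ s := (mem_filter.mp ha₀).1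
    have hga₀ : g a₀ ≠ 0 := (mem_filter.mp ha₀).2
    have hFa₀ : F a₀ = g a₀ := by
      simp only [F]
      rw [sum_eq_single_of_mem a₀ ha₀s]
      · unfold flatInd
        rw [sub_self, if_pos (Submodule.zero_mem _), mul_one]
      · intro a has hne'
        by_cases hg : g a = 0
        · rw [hg, zero_mul]
        · have haS' : a ∈ S' := by rw [hS']; exact mem_filter.mpr ⟨has, hg⟩
          unfold flatInd
          rw [if_neg, mul_zero]
          intro hv
          have hup' := hup a a.2 _ hv
          have hwt : wt (a₀ : V N) = wt (a : V N) + wt ((a₀ : V N) - (a : V N)) := by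
            have := wt_add_of_upward hup'
            rwa [add_sub_cancel] at this
          have hle := hmin a haS'
          have hz : wt ((a₀ : V N) - (a : V N)) = 0 := by omega
          have h0 : (a₀ : V N) - (a : V N) = 0 := eq_zero_of_wt_eq_zero hz
          exact hne' (Subtype.ext (sub_eq_zero.mp h0).symm)
    exact hga₀ (hFa₀ ▸ hFzero a₀)
  have := hli.fintype_card_le_finrank
  rw [Module.finrank_pi, Fintype.card_coe, Fintype.card_coe] at this
  exact this

end

end Summit.PneNP.PneNP.Theorems.ClusCube
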